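import Summits.HubbardSuperconductivity.HubbardSuperconductivity.Theorems.SoloBlindTwistAveraging
import HarnessLib

/-!
# The gauge orbit of the Hubbard torus: the d-wave ground-state bound is not a unitary invariant

Part 4 of the obstruction lemma (`SoloBlindGaugeTwist`, `SoloBlindTwistAveraging`,
`SoloBlindOrderNotEnergyRobust`), Hamiltonian-side form. The `L` PEIERLS COPIES
`H_m = magneticHubbardTorus L (flatConfig e^{2πi m/L}) t U` (`m ∈ ℤ/L`: the Hubbard torus with the
uniform hopping phase `e^{2πi m/L}` on every `e₁`-bond; total flux through the torus `2πm ≡ 0`) are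
the conjugates `W_m H W_mᴴ` of `H = hubbardTorus 2 L t U` by the twist unitaries
(`twistOp_mul_hubbardTorus_mul_conjTranspose`): one orbit of the local, sector-preserving gauge
group. This file proves, for all `t, U` and `L ≥ 3`:

* `fluxCopy_zero`, `charpoly_fluxCopy`, `minEnergyOn_fluxCopy`, `isGroundStateInSector_fluxCopy_iff`:
  `H_0 = H`; every copy has the characteristic polynomial of `H` (spectrum with multiplicities —
  hence the same partition function and thermodynamic functions at every `β`), the same ground
  energy in every joint sector `(N, S^z)`, and its sector ground states are exactly the twisted
  ground states `W_m ψ` of `H`; `fluxCopy_sub`, `norm_toCircle_natCast_sub_one_le`: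
  `H_m - H = -t((e^{2πim/L} - 1)K₁ + h.c.)`, each hopping amplitude moving by at most `2π|m||t|/L`.
* `card_filter_twist_order_ge_mul_le` — COUNTING form of momentum averaging
  (`sum_twist_pairField_order_le`): for every state `ψ`, form factor `|g| ≤ 1` and `c > 0`, at most
  `400‖ψ‖²/c` of the `L` twisted copies `W_mᴴψ` have pair-field order `re ⟨Δ_g†Δ_g⟩ ≥ cL⁴`.
* `exists_fluxCopy_groundState_order_lt` — **headline**: if `400/c < L`, then in every joint sector
  possessing a ground state, SOME copy `H_m` has a normalised sector ground state with
  `re ⟨Δ_g†Δ_g⟩ < cL⁴`; `exists_small_winding_fluxCopy_groundState_order_lt`: the winding can be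
  taken `m = -j`, `0 ≤ j < M` for any `M > 400/c` (`M ≤ L`), i.e. a hopping phase within `2πM/L` of
  zero suffices, and the state lies within `8π²|t|(j² + j)` of the ground energy of `H` itself.
* `not_gaugeInvariant_criterion`, `not_unitaryInvariant_criterion` — **no invariant criterion**: a
  property `Φ` of Hamiltonians that takes the same value on all copies `H_m` (in particular any
  unitary invariant: the spectrum with multiplicities, all sector energies and gaps, the
  tower-of-states structure, `Z(β)` and the free energy at every `β`) and which is a sufficient
  condition for the bound `re ⟨Δ_g†Δ_g⟩ ≥ cL⁴` on all normalised ground states of a sector, is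
  FALSE for `H` as soon as `L > 400/c` and the sector has a ground state.

Reading. The summit asks for `re ⟨Δ_d†Δ_d⟩_ψ ≥ cL⁴` for EVERY normalised ground state of the
`(N_L, S^z = 0)` sector (`hubbardSuperconductivity_iff_uniform_dWave_bound`). Of the `L`
gauge-equivalent, isospectral, translation-invariant presentations `H_m` of the same physical
system, at most `400/c` can have this property; a proof must therefore use the datum that
distinguishes `H = H_0` inside its gauge orbit — the vanishing of the Peierls phase (reality of the
hopping matrix) — at resolution `2π(400/c + 1)/L` per bond, and no amount of spectral or
thermodynamic information can substitute for it. References: E. H. Lieb, Phys. Rev. Lett. 73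
(1994) 2158 (gauge classes of flux Hamiltonians); T. Koma, H. Tasaki, Phys. Rev. Lett. 68 (1992)
3248, eqs. (5)–(8); H. Watanabe, J. Stat. Phys. 177 (2019) 717, arXiv:1904.02700, §2.2.3
(`U_m† H U_m = H^{(2πm/L)}`); E. Lieb, T. Schultz, D. Mattis, Ann. Phys. 16 (1961) 407.
Elementary; every declaration is tagged [folklore].
-/

noncomputable section

namespace Summit.HubbardSuperconductivity.HubbardSuperconductivity.Theorems

open Matrix Finset Literature.MathematicalPhysics.QuantumLattice
  Literature.MathematicalPhysics.QuantumFieldTheory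
open Literature.Probability.LatticeModels (Torus.proj)
open scoped ComplexConjugate

namespace GaugeTwist

-- see `SoloBlindCertificateFromGap`: make instance synthesis agree with the landed terms
-- (`DecidableEq (FermionTorus 2 L)` through the linear order, not Mathlib's generic
-- `instDecidableEqLex`), file-locally; no instance is added.
attribute [-instance] instDecidableEqLex

variable {L : ℕ} [NeZero L]

/-! ### The Peierls copies `H_m = W_m H W_mᴴ` -/

/-- `χ_{-m} = χ_m⁻¹` for the twist characters. [folklore] -/
theorem twistChar_neg (m : ZMod L) : twistChar (-m) = (twistChar (L := L) m)⁻¹ := by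
  funext x
  simp only [twistChar, Pi.inv_apply, neg_mul, AddChar.map_neg_eq_inv]

/-- `W_mᴴ W_m = 1`. [folklore] -/
theorem twistOp_conjTranspose_mul_self (m : ZMod L) : (twistOp (L := L) m)ᴴ * twistOp m = 1 := by
  unfold twistOp
  exact conjTranspose_phaseGauge_mul_self fun u : FermionTorus 2 L => twistChar m u.toTorusSite

/-- `W_m W_mᴴ = 1`. [folklore] -/
theorem twistOp_mul_conjTranspose_self (m : ZMod L) : twistOp (L := L) m * (twistOp m)ᴴ = 1 := by
  unfold twistOp
  exact phaseGauge_mul_conjTranspose_self fun u : FermionTorus 2 L => twistChar m u.toTorusSite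

/-- `W_mᴴ` is the site-phase unitary of the inverse character `χ_m⁻¹`. [folklore] -/
theorem twistOp_conjTranspose_eq (m : ZMod L) :
    (twistOp (L := L) m)ᴴ =
      phaseGauge fun u : FermionTorus 2 L => (twistChar m)⁻¹ u.toTorusSite :=
  (phaseGauge_conjTranspose _).trans rfl

/-- `W_mᴴ = W_{-m}`. [folklore] -/
theorem twistOp_conjTranspose (m : ZMod L) : (twistOp (L := L) m)ᴴ = twistOp (-m) := by
  rw [twistOp_conjTranspose_eq, twistOp, twistChar_neg]

omit [NeZero L] in
/-- The flat field with phase `1` is the trivial gauge field. [folklore] -/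
theorem flatConfig_one : flatConfig (L := L) 1 = 1 := by
  funext e
  obtain ⟨x, i⟩ := e
  rw [flatConfig_apply, Pi.one_apply, ite_self]

/-- The copy of winding `0` is the Hubbard torus itself (`L ≥ 3`). [folklore] -/
theorem fluxCopy_zero (hL : 3 ≤ L) (t U : ℝ) :
    magneticHubbardTorus L (flatConfig (ZMod.toCircle (0 : ZMod L))) t U = hubbardTorus 2 L t U := by
  rw [AddChar.map_zero_eq_one, flatConfig_one, magneticHubbardTorus_one_eq_hubbardTorus hL]

/-- **The copies are isospectral** (`L ≥ 3`): `H_m = W_m H W_mᴴ` has the characteristic polynomial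
of `H` — the same eigenvalues with the same multiplicities, hence the same partition function
`tr e^{-βH}` and thermodynamic functions at every `β`. Lieb, PRL 73 (1994) 2158. [folklore] -/
theorem charpoly_fluxCopy (hL : 3 ≤ L) (m : ZMod L) (t U : ℝ) :
    (magneticHubbardTorus L (flatConfig (ZMod.toCircle m)) t U).charpoly =
      (hubbardTorus 2 L t U).charpoly := by
  rw [← twistOp_mul_hubbardTorus_mul_conjTranspose hL, Matrix.mul_assoc, Matrix.charpoly_mul_comm,
    Matrix.mul_assoc, twistOp_conjTranspose_mul_self, Matrix.mul_one]

/-- **The copies have the ground energy of `H` in every joint sector** `(N, S^z)` (`L ≥ 3`).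
[folklore] -/
theorem minEnergyOn_fluxCopy (hL : 3 ≤ L) (m : ZMod L) (t U : ℝ) (N : ℕ) (Mz : ℝ) :
    (magneticHubbardTorus L (flatConfig (ZMod.toCircle m)) t U).minEnergyOn (szSector N Mz) =
      (hubbardTorus 2 L t U).minEnergyOn (szSector N Mz) := by
  rw [← gaugeTransform_twistChar_inv_one]
  exact minEnergyOn_szSector_gaugeTransform_one hL _ t U N Mz

/-- **The sector ground states of a copy are the twisted ground states** (`L ≥ 3`): `φ` is a
ground state of `H_m` in the joint sector `(N, S^z)` iff `W_mᴴ φ` is one of `H` there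
(equivalently `φ = W_m ψ` with `ψ` a sector ground state of `H`). Koma–Tasaki, PRL 68 (1992)
3248, eqs. (5)–(8). [folklore] -/
theorem isGroundStateInSector_fluxCopy_iff (hL : 3 ≤ L) (m : ZMod L) (t U : ℝ) (N : ℕ) (Mz : ℝ)
    (φ : Fock (Orb (FermionTorus 2 L))) :
    IsGroundStateInSector (magneticHubbardTorus L (flatConfig (ZMod.toCircle m)) t U) N Mz φ ↔
      IsGroundStateInSector (hubbardTorus 2 L t U) N Mz ((twistOp m)ᴴ *ᵥ φ) := by
  rw [twistOp_conjTranspose_eq, ← gaugeTransform_twistChar_inv_one]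
  exact isGroundStateInSector_gaugeTransform_one_iff hL _ t U N Mz φ

/-- **Each copy differs from `H` by a small change of every `e₁`-hopping amplitude** (`L ≥ 3`):
`H_m - H = -t((e^{2πim/L} - 1) K₁ + (e^{-2πim/L} - 1) K₁ᴴ)` with `K₁ = hopE1`. [folklore] -/
theorem fluxCopy_sub (hL : 3 ≤ L) (m : ZMod L) (t U : ℝ) :
    magneticHubbardTorus L (flatConfig (ZMod.toCircle m)) t U - hubbardTorus 2 L t U =
      (-(t : ℂ)) • ((((ZMod.toCircle m : Circle) : ℂ) - 1) • hopE1 +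
        (conj ((ZMod.toCircle m : Circle) : ℂ) - 1) • (hopE1)ᴴ) := by
  rw [← magneticHubbardTorus_one_eq_hubbardTorus hL]
  exact magneticHubbardTorus_flatConfig_sub _ t U

/-- `‖e^{2πij/L} - 1‖ ≤ 2πj/L`: the Peierls phase of the copy of winding `j` lies within `2πj/L`
of `1`. [folklore] -/
theorem norm_toCircle_natCast_sub_one_le (j : ℕ) :
    ‖((ZMod.toCircle ((j : ℕ) : ZMod L) : Circle) : ℂ) - 1‖ ≤ 2 * Real.pi * j / L := by
  have h : ((ZMod.toCircle ((j : ℕ) : ZMod L) : Circle) : ℂ) =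
      ((ZMod.toCircle (1 : ZMod L) : Circle) : ℂ) ^ j := by
    rw [← Circle.coe_pow, ← AddChar.map_nsmul_eq_pow, nsmul_eq_mul, mul_one]
  rw [h]
  refine (norm_pow_sub_one_le_of_norm_eq_one (Circle.norm_coe _) j).trans ?_
  calc (j : ℝ) * ‖((ZMod.toCircle (1 : ZMod L) : Circle) : ℂ) - 1‖ ≤ j * (2 * Real.pi / L) :=
        mul_le_mul_of_nonneg_left norm_toCircle_one_sub_one_le (Nat.cast_nonneg j)
    _ = 2 * Real.pi * j / L := by ring

/-- `‖e^{-2πij/L} - 1‖ ≤ 2πj/L`: the same bound for the copy of winding `-j`. [folklore] -/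
theorem norm_toCircle_neg_natCast_sub_one_le (j : ℕ) :
    ‖((ZMod.toCircle (-((j : ℕ) : ZMod L)) : Circle) : ℂ) - 1‖ ≤ 2 * Real.pi * j / L := by
  have h : conj ((ZMod.toCircle ((j : ℕ) : ZMod L) : Circle) : ℂ) - 1 =
      conj (((ZMod.toCircle ((j : ℕ) : ZMod L) : Circle) : ℂ) - 1) := by
    rw [map_sub, map_one]
  rw [AddChar.map_neg_eq_inv, Circle.coe_inv_eq_conj, h, Complex.norm_conj]
  exact norm_toCircle_natCast_sub_one_le j

/-! ### Counting form of momentum averaging -/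

/-- **At most `400‖ψ‖²/c` twisted copies of any state carry pair-field order `≥ cL⁴`**
(`|g| ≤ 1`; informative for `c > 0`): the counting version of `sum_twist_pairField_order_le`.
[folklore] -/
theorem card_filter_twist_order_ge_mul_le (g : (Fin 2 → ℤ) → ℝ) (hg : ∀ e, |g e| ≤ 1)
    (ψ : Fock (Orb (FermionTorus 2 L))) (c : ℝ) :
    ((Finset.univ.filter fun m : ZMod L => c * (L : ℝ) ^ 4 ≤
        (star (pairField g L *ᵥ ((twistOp m)ᴴ *ᵥ ψ)) ⬝ᵥ
          (pairField g L *ᵥ ((twistOp m)ᴴ *ᵥ ψ))).re).card : ℝ) * c ≤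
      400 * (star ψ ⬝ᵥ ψ).re := by
  set T : ZMod L → ℝ := fun m => (star (pairField g L *ᵥ ((twistOp m)ᴴ *ᵥ ψ)) ⬝ᵥ
    (pairField g L *ᵥ ((twistOp m)ᴴ *ᵥ ψ))).re with hT
  have hT0 : ∀ m, 0 ≤ T m := fun m => by
    simp only [hT]
    rw [← norm_toLp_sq_eq_re]
    positivity
  have htot : ∑ m : ZMod L, T m ≤ 400 * (L : ℝ) ^ 4 * (star ψ ⬝ᵥ ψ).re :=
    sum_twist_pairField_order_le g hg ψ
  set F := Finset.univ.filter fun m : ZMod L => c * (L : ℝ) ^ 4 ≤ T m with hF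
  have h1 : (F.card : ℝ) * (c * (L : ℝ) ^ 4) ≤ ∑ m ∈ F, T m := by
    rw [← nsmul_eq_mul]
    exact Finset.card_nsmul_le_sum F T _ fun m hm => (Finset.mem_filter.1 hm).2
  have h2 : ∑ m ∈ F, T m ≤ ∑ m : ZMod L, T m :=
    Finset.sum_le_sum_of_subset_of_nonneg (Finset.subset_univ _) fun m _ _ => hT0 m
  have hL0 : (0 : ℝ) < (L : ℝ) ^ 4 := by
    have : (0 : ℝ) < L := by exact_mod_cast Nat.pos_of_ne_zero (NeZero.ne L)
    positivity
  have h3 : (F.card : ℝ) * c * (L : ℝ) ^ 4 ≤ 400 * (star ψ ⬝ᵥ ψ).re * (L : ℝ) ^ 4 := by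
    calc (F.card : ℝ) * c * (L : ℝ) ^ 4 = (F.card : ℝ) * (c * (L : ℝ) ^ 4) := by ring
      _ ≤ 400 * (L : ℝ) ^ 4 * (star ψ ⬝ᵥ ψ).re := h1.trans (h2.trans htot)
      _ = 400 * (star ψ ⬝ᵥ ψ).re * (L : ℝ) ^ 4 := by ring
  exact le_of_mul_le_mul_right h3 hL0

/-! ### Headline: some gauge copy violates the every-ground-state bound -/

/-- **Some Peierls copy has a sector ground state with small pair-field order** (`L ≥ 3`,
`|g| ≤ 1`, `c > 0`, `400/c < L`). For every joint sector `(N, S^z)` of `H = hubbardTorus 2 L t U`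
possessing a normalised ground state `ψ` there is a winding `m ∈ ℤ/L` such that the isospectral,
gauge-equivalent copy `H_m` (Peierls phase `e^{2πim/L}` on the `e₁`-bonds) has a NORMALISED ground
state `φ` in the same sector — a twisted copy of `ψ` — with `re ⟨Δ_g† Δ_g⟩_φ < c L⁴`. [folklore] -/
theorem exists_fluxCopy_groundState_order_lt (hL : 3 ≤ L) (t U : ℝ) {c : ℝ} (hc : 0 < c)
    (hcL : 400 / c < L) (g : (Fin 2 → ℤ) → ℝ) (hg : ∀ e, |g e| ≤ 1) {N : ℕ} {Mz : ℝ}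
    {ψ : Fock (Orb (FermionTorus 2 L))} (hψ : IsGroundStateInSector (hubbardTorus 2 L t U) N Mz ψ)
    (h1 : star ψ ⬝ᵥ ψ = 1) :
    ∃ m : ZMod L, ∃ φ : Fock (Orb (FermionTorus 2 L)),
      IsGroundStateInSector (magneticHubbardTorus L (flatConfig (ZMod.toCircle m)) t U) N Mz φ ∧
        star φ ⬝ᵥ φ = 1 ∧ (expect ((pairField g L)ᴴ * pairField g L) φ).re < c * (L : ℝ) ^ 4 := by
  -- some twisted copy `W_mᴴ ψ` of `ψ` has order `< cL⁴`
  obtain ⟨m, hm⟩ : ∃ m : ZMod L, (star (pairField g L *ᵥ ((twistOp m)ᴴ *ᵥ ψ)) ⬝ᵥ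
      (pairField g L *ᵥ ((twistOp m)ᴴ *ᵥ ψ))).re < c * (L : ℝ) ^ 4 := by
    by_contra! h
    have hcard := card_filter_twist_order_ge_mul_le g hg ψ c
    rw [h1, Complex.one_re, mul_one, Finset.filter_true_of_mem fun m _ => h m, Finset.card_univ,
      ZMod.card] at hcard
    rw [div_lt_iff₀ hc] at hcL
    linarith
  -- it is a ground state of the copy `H_{-m} = W_{-m} H W_m`
  refine ⟨-m, (twistOp m)ᴴ *ᵥ ψ, ?_, by rw [star_twist_dotProduct_twist, h1], ?_⟩
  · rw [isGroundStateInSector_fluxCopy_iff hL, twistOp_conjTranspose (-m), neg_neg, mulVec_mulVec,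
      twistOp_mul_conjTranspose_self, one_mulVec]
    exact hψ
  · rwa [PosSemidefTrace.expect_conjTranspose_mul]

/-- **Quantitative form: a small winding suffices** (`L ≥ 3`, `|g| ≤ 1`, `c > 0`,
`400/c < M ≤ L`). The copy can be taken with winding `-j`, `0 ≤ j < M` — Peierls phase
`e^{-2πij/L}`, within `2πM/L` of `1` (`norm_toCircle_neg_natCast_sub_one_le`) — and its small-order
ground state `φ = W_jᴴ ψ` then also lies within `8π²|t|(j² + j) ≤ 8π²|t|M²` of the ground energy of
`H` itself (`re_twist_energy_le_minEnergyOn_add`). [folklore] -/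
theorem exists_small_winding_fluxCopy_groundState_order_lt (hL : 3 ≤ L) (t U : ℝ) {c : ℝ}
    (hc : 0 < c) {M : ℕ} (hcM : 400 / c < M) (hML : M ≤ L) (g : (Fin 2 → ℤ) → ℝ)
    (hg : ∀ e, |g e| ≤ 1) {N : ℕ} {Mz : ℝ} {ψ : Fock (Orb (FermionTorus 2 L))}
    (hψ : IsGroundStateInSector (hubbardTorus 2 L t U) N Mz ψ) (h1 : star ψ ⬝ᵥ ψ = 1) :
    ∃ j : ℕ, j < M ∧ ∃ φ : Fock (Orb (FermionTorus 2 L)),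
      IsGroundStateInSector
          (magneticHubbardTorus L (flatConfig (ZMod.toCircle (-((j : ℕ) : ZMod L)))) t U) N Mz φ ∧
        star φ ⬝ᵥ φ = 1 ∧
        (expect ((pairField g L)ᴴ * pairField g L) φ).re < c * (L : ℝ) ^ 4 ∧
        (star φ ⬝ᵥ (hubbardTorus 2 L t U *ᵥ φ)).re ≤
          (hubbardTorus 2 L t U).minEnergyOn (szSector N Mz) +
            8 * Real.pi ^ 2 * |t| * ((j : ℝ) ^ 2 + j) := by
  set T : ZMod L → ℝ := fun m => (star (pairField g L *ᵥ ((twistOp m)ᴴ *ᵥ ψ)) ⬝ᵥ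
    (pairField g L *ᵥ ((twistOp m)ᴴ *ᵥ ψ))).re with hT
  have hT0 : ∀ m, 0 ≤ T m := fun m => by
    simp only [hT]
    rw [← norm_toLp_sq_eq_re]
    positivity
  have htot : ∑ m : ZMod L, T m ≤ 400 * (L : ℝ) ^ 4 := by
    have := sum_twist_pairField_order_le g hg ψ
    rwa [h1, Complex.one_re, mul_one] at this
  set S : Finset ℕ := Finset.range M with hS
  have hinj : ∀ i ∈ S, ∀ j ∈ S, ((i : ℕ) : ZMod L) = ((j : ℕ) : ZMod L) → i = j := by
    intro i hi j hj hij
    rw [hS, Finset.mem_range] at hi hj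
    have := (ZMod.natCast_eq_natCast_iff' i j L).1 hij
    rwa [Nat.mod_eq_of_lt (by omega), Nat.mod_eq_of_lt (by omega)] at this
  have hpart : ∑ j ∈ S, T (j : ZMod L) ≤ 400 * (L : ℝ) ^ 4 := by
    rw [← Finset.sum_image hinj]
    exact (Finset.sum_le_sum_of_subset_of_nonneg (Finset.subset_univ _) fun m _ _ => hT0 m).trans
      htot
  obtain ⟨j, hjS, hj⟩ : ∃ j ∈ S, T (j : ZMod L) < c * (L : ℝ) ^ 4 := by
    by_contra! h
    have h1' : (S.card : ℝ) * (c * (L : ℝ) ^ 4) ≤ ∑ j ∈ S, T (j : ZMod L) := by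
      rw [← nsmul_eq_mul]
      exact Finset.card_nsmul_le_sum S _ _ h
    have hcardS : S.card = M := by rw [hS, Finset.card_range]
    rw [hcardS] at h1'
    have hL0 : (0 : ℝ) < (L : ℝ) ^ 4 := by
      have : (0 : ℝ) < L := by exact_mod_cast Nat.pos_of_ne_zero (NeZero.ne L)
      positivity
    have h2 : (M : ℝ) * c * (L : ℝ) ^ 4 ≤ 400 * (L : ℝ) ^ 4 := by
      calc (M : ℝ) * c * (L : ℝ) ^ 4 = (M : ℝ) * (c * (L : ℝ) ^ 4) := by ring
        _ ≤ 400 * (L : ℝ) ^ 4 := h1'.trans hpart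
    have h3 : (M : ℝ) * c ≤ 400 := le_of_mul_le_mul_right h2 hL0
    rw [div_lt_iff₀ hc] at hcM
    linarith
  rw [hS, Finset.mem_range] at hjS
  refine ⟨j, hjS, (twistOp (j : ZMod L))ᴴ *ᵥ ψ, ?_, by rw [star_twist_dotProduct_twist, h1],
    ?_, ?_⟩
  · rw [isGroundStateInSector_fluxCopy_iff hL, twistOp_conjTranspose (-((j : ℕ) : ZMod L)),
      neg_neg, mulVec_mulVec, twistOp_mul_conjTranspose_self, one_mulVec]
    exact hψ
  · rw [PosSemidefTrace.expect_conjTranspose_mul]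
    exact hj
  · exact re_twist_energy_le_minEnergyOn_add hL t U hψ h1 j (Or.inl rfl)

/-! ### No gauge-invariant (in particular no unitarily invariant) criterion -/

/-- **No gauge-invariant sufficient condition** (`L ≥ 3`, `|g| ≤ 1`, `c > 0`, `400/c < L`). Let
`Φ` be a property of Hamiltonians taking the same value on all Peierls copies `H_m` of
`H = hubbardTorus 2 L t U`, and suppose that on every copy `Φ` implies the bound
`re ⟨Δ_g† Δ_g⟩ ≥ cL⁴` for all normalised ground states of the joint sector `(N, S^z)`. If that
sector of `H` has a ground state, then `Φ(H)` is false. [folklore] -/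
theorem not_gaugeInvariant_criterion (hL : 3 ≤ L) (t U : ℝ) {c : ℝ} (hc : 0 < c)
    (hcL : 400 / c < L) (g : (Fin 2 → ℤ) → ℝ) (hg : ∀ e, |g e| ≤ 1)
    (Φ : Matrix (Finset (Orb (FermionTorus 2 L))) (Finset (Orb (FermionTorus 2 L))) ℂ → Prop)
    (hinv : ∀ m : ZMod L,
      Φ (magneticHubbardTorus L (flatConfig (ZMod.toCircle m)) t U) ↔ Φ (hubbardTorus 2 L t U))
    {N : ℕ} {Mz : ℝ}
    (hΦ : ∀ m : ZMod L, Φ (magneticHubbardTorus L (flatConfig (ZMod.toCircle m)) t U) →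
      ∀ φ : Fock (Orb (FermionTorus 2 L)),
        IsGroundStateInSector (magneticHubbardTorus L (flatConfig (ZMod.toCircle m)) t U) N Mz φ →
          star φ ⬝ᵥ φ = 1 → c * (L : ℝ) ^ 4 ≤ (expect ((pairField g L)ᴴ * pairField g L) φ).re)
    {ψ : Fock (Orb (FermionTorus 2 L))} (hψ : IsGroundStateInSector (hubbardTorus 2 L t U) N Mz ψ)
    (h1 : star ψ ⬝ᵥ ψ = 1) : ¬ Φ (hubbardTorus 2 L t U) := by
  intro h
  obtain ⟨m, φ, hφ, hφ1, hlt⟩ := exists_fluxCopy_groundState_order_lt hL t U hc hcL g hg hψ h1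
  exact (not_le.2 hlt) (hΦ m ((hinv m).2 h) φ hφ hφ1)

/-- **No unitarily invariant sufficient condition** (`L ≥ 3`, `|g| ≤ 1`, `c > 0`, `400/c < L`).
Let `Φ` be a property of operators on the Fock space of the `L × L` torus that is invariant under
unitary conjugation (so `Φ` depends only on the spectrum with multiplicities — e.g. any statement
about eigenvalues, gaps, degeneracies, `tr e^{-βH}`, free energies), and suppose `Φ(H')` implies,
for every `H'`, the bound `re ⟨Δ_g† Δ_g⟩ ≥ cL⁴` on all normalised ground states of `H'` in the
joint sector `(N, S^z)`. If that sector of the Hubbard torus `H` has a ground state, then `Φ(H)`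
is false: the every-ground-state pair-order bound is not a consequence of any unitary invariant.
[folklore] -/
theorem not_unitaryInvariant_criterion (hL : 3 ≤ L) (t U : ℝ) {c : ℝ} (hc : 0 < c)
    (hcL : 400 / c < L) (g : (Fin 2 → ℤ) → ℝ) (hg : ∀ e, |g e| ≤ 1)
    (Φ : Matrix (Finset (Orb (FermionTorus 2 L))) (Finset (Orb (FermionTorus 2 L))) ℂ → Prop)
    (hinv : ∀ W H' : Matrix (Finset (Orb (FermionTorus 2 L))) (Finset (Orb (FermionTorus 2 L))) ℂ,
      Wᴴ * W = 1 → (Φ (W * H' * Wᴴ) ↔ Φ H'))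
    {N : ℕ} {Mz : ℝ}
    (hΦ : ∀ H' : Matrix (Finset (Orb (FermionTorus 2 L))) (Finset (Orb (FermionTorus 2 L))) ℂ,
      Φ H' → ∀ φ : Fock (Orb (FermionTorus 2 L)), IsGroundStateInSector H' N Mz φ →
        star φ ⬝ᵥ φ = 1 → c * (L : ℝ) ^ 4 ≤ (expect ((pairField g L)ᴴ * pairField g L) φ).re)
    {ψ : Fock (Orb (FermionTorus 2 L))} (hψ : IsGroundStateInSector (hubbardTorus 2 L t U) N Mz ψ)
    (h1 : star ψ ⬝ᵥ ψ = 1) : ¬ Φ (hubbardTorus 2 L t U) :=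
  not_gaugeInvariant_criterion hL t U hc hcL g hg Φ
    (fun m => by
      rw [← twistOp_mul_hubbardTorus_mul_conjTranspose hL]
      exact hinv _ _ (twistOp_conjTranspose_mul_self m))
    (fun m h => hΦ _ h) hψ h1

end GaugeTwist

end Summit.HubbardSuperconductivity.HubbardSuperconductivity.Theorems
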